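import Mathlib
import HarnessLib
import Summits.QuantumAdvantage.QuantumAdvantage.Theses.GenericInertness
import Literature.Computability.QuantumComplexity.PromiseClassesRel

/-!
# Birth skeleton — crux `GenSep` of route `GenericInertness` (stmt-QuantumAdvantage-1823)

`GenSep` ("sufficiently generic oracles separate `BQP` from `BPP`": for every countable family `𝒮` of
sets of Cohen conditions some `𝒮`-generic `G` has `BQP^G ⊄ BPP^G`) is the route's RELOCATED TARGET:
necessary for the summit (`PositiveTransfer`, FFKL03 L.4.3/Cor 4.6) and sufficient given the bridge
crux `LangInertness` (`closes`). Its only attack that is not "prove the summit first" is a forcing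
argument, and at a Cohen generic the forcing/query-complexity technology reaches exactly the PROMISE
classes. This skeleton cuts `GenSep` along that seam (the relativized textbook promise classes
`PromiseBQPRel`, `PromiseBPP'Rel` of `Literature/Computability/QuantumComplexity/PromiseClassesRel.lean`):

* `stub_genericPromiseSep` (L, PROVABLE NOW — Forrelation/Simon at a Cohen generic): there is a countable
  family `𝒮₀` of sets of conditions such that every `𝒮₀`-generic `G` has `PromiseBQP^G ⊄ PromiseBPP'^G`.
  Plan (all ingredients are tree theorems outside `Literature.Barriers`): the promise problem
  `machinePromise F G = ({x : acc ≥ 2/3}, {x : acc ≤ 1/3})` of the uniform prefixed Raz–Tal machine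
  `F` (`razTalPrefixed_bqpMachine`, `RazTalPrefixedMachine.lean`: amplified Forrelation test `Q₁` on the
  level-`n` window of `G` read at the addresses `1 · rtAddr n i k`) is in `PromiseBQP^G` for EVERY `G`
  by definition; for each `bp(P^G)` description `(M, q, p)` the conditions forcing "at some level `n`,
  `Q₁` is on one side of the promise at `1ⁿ` while the acceptance probability of `(M, q, p)` is not" are
  DENSE — given `τ`, take `n` beyond the lengths in `dom τ`, run the stage lemma
  `exists_defeating_window_bpp` (`OracleSeparationBQPBPP.lean`; its three named inputs are proved:
  `razTal2022_claim81_holds`, `fSS84_phWindowCircuits_holds`, `razTal2022_thm74_of_tal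
  Tal2017_fourierL1_ac0_holds`) against `M` with the `0·`/root part of the background answered by a
  local rule (pattern `withLocalRule`/`exists_forces_promiseLiftFailsAt` of
  `PromiseLiftRelativization.lean`, there for the joined oracle `K ⊕ G`; here no base), patch the
  defeating window into level `n` and freeze every string up to the reach of the description into a
  finite condition; `𝒮₀` := the countably many forcing sets (`exists_enum_PHDescr
  countable_polyTimeOracleAlg_holds`), and `IsGeneric.of_forces` meets each. (Simon's problem with its
  elementary `Ω(2^{n/2})` classical bound is an alternative witness.)
  Sources: RazTalJACM2022 App. A (Claims 8.1–8.2), BernsteinVazirani1997 Cor. 8.14, Simon1997,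
  FennerFortnowKurtzLi2003IC §3–4 (L.3.12, L.4.1), FortnowRogers1999JCSS §2.6.
* `stub_genericPromiseLift` (the OPEN CORE — the promise lift AT a Cohen generic): there is a countable
  `𝒮₁` such that for every `𝒮₁`-generic `G`, `BQP^G ⊆ BPP^G ⟹ PromiseBQP^G ⊆ PromiseBPP'^G` — the
  instance at comeager-many oracles of the lift shape `O ↦ (BQP^O ⊆ BPP^O → PromiseBQP^O ⊆ PromiseBPP'^O)`
  whose `O = ∅` instance is route PromiseLift's `PlLift` (stmt-QuantumAdvantage-0250) and which FAILS at
  the brain-join oracles `O = K ⊕ G'` (`PromiseLiftRelativization.holds`: language classes collapse,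
  the Forrelation promise problem survives) — harmless here since "`G` is not of the form `K ⊕ ·`" is
  forced densely and may be put into `𝒮₁`, but it shows the stub, like `GenSep`, has no proof that
  relativizes in a base oracle. Calibration: NECESSARY for the summit (S ⟹ `BQP^G ⊄ BPP^G` for all
  sufficiently generic `G` by positive transfer, FFKL03 L.4.3, making the implication vacuous); given
  stub 1 it is the COMEAGER form of `GenSep` (a 0-1-law strengthening: properties won by forcing hold
  comeagerly), i.e. this cut isolates the language/promise gap at a generic as the entire residue —
  the separation-side dual of the route's bridge crux `LangInertness`.
  Sources: AaronsonArkhipov2013 §10 (open problems 9–10), Goldreich2011 §6, FennerFortnowKurtzLi2003IC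
  Thm 6.18 (2), FortnowRogers1999JCSS Cor. 3.7 / Cor. 3.11, tree `Literature.Barriers.QuantumAdvantage.
  PromiseLiftRelativization` (read, NOT imported: cone hygiene of the route).

Composition `GenSep_of` (no sorry, 8 lines): given `𝒮`, take `G` generic for `𝒮 ∪ 𝒮₀ ∪ 𝒮₁`
(`exists_isGeneric`, `isGeneric_union`); `G` is `𝒮`-generic, and `BQP^G ⊆ BPP^G` would give
`PromiseBQP^G ⊆ PromiseBPP'^G` by the lift, contradicting the promise separation.

Disproof used: none exists for this crux (no `Cruxes/GenSep/Disproof.lean` at registration time).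
Negatives index (`ledger negatives --problem QuantumAdvantage`, 2026-08-17: 6 refuted statements —
RegulatorThird, ShorLocallyDark, CubicStability, SpinorFlattening GaussRankPoly, KummerSector, SeparableFrames):
none concerns generic oracles or relativized promise classes, so neither stub restates a refuted statement.
BC3 probes (folder `bc/GenSep_probe*.lean`, statements inlined, `first | exact? | simpa | aesop` and the
extended BC2 combinator): `stubᵢ → GenSep` and `stubᵢ → QuantumAdvantage` FAIL for both stubs (also the
converses, `stub₁ ↔ stub₂`, and `example : stubᵢ := by exact?`).
-/

set_option linter.dupNamespace false

namespace Summit.QuantumAdvantage.QuantumAdvantage.Cruxes.GenSep.Birth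

open Literature.Computability.Complexity Literature.Computability.Cryptography
open Literature.Computability.QuantumComplexity

/-! ### The two stub statements (named, so that the composition is keyed by stub name) -/

/-- Statement of STUB 1: COHEN GENERICS SEPARATE THE PROMISE CLASSES — some countable family of sets of
conditions `𝒮₀` is such that every `𝒮₀`-generic oracle `G` has `PromiseBQP^G ⊄ PromiseBPP'^G`. -/
def GenericPromiseSep : Prop :=
  ∃ 𝒮₀ : Set (Set Literature.Computability.Complexity.CohenCondition), 𝒮₀.Countable ∧
    ∀ G : Language Bool, Literature.Computability.Complexity.IsGeneric 𝒮₀ G →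
      ¬ (Literature.Computability.QuantumComplexity.PromiseBQPRel G ⊆
          Literature.Computability.QuantumComplexity.PromiseBPP'Rel
            (Literature.Computability.Complexity.Oracle.ofLanguage G))

/-- Statement of STUB 2: THE PROMISE LIFT AT A COHEN GENERIC — some countable `𝒮₁` is such that for
every `𝒮₁`-generic `G`, a collapse of the LANGUAGE classes `BQP^G ⊆ BPP^G` already forces the collapse
of the PROMISE classes `PromiseBQP^G ⊆ PromiseBPP'^G`. (The converse implication holds at every oracle:
`BQPRel_subset_BPPRel_of_promise`.) -/
def GenericPromiseLift : Prop :=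
  ∃ 𝒮₁ : Set (Set Literature.Computability.Complexity.CohenCondition), 𝒮₁.Countable ∧
    ∀ G : Language Bool, Literature.Computability.Complexity.IsGeneric 𝒮₁ G →
      Literature.Computability.Cryptography.BQPRel G ⊆
          Literature.Computability.Complexity.BPPRel
            (Literature.Computability.Complexity.Oracle.ofLanguage G) →
        Literature.Computability.QuantumComplexity.PromiseBQPRel G ⊆
          Literature.Computability.QuantumComplexity.PromiseBPP'Rel
            (Literature.Computability.Complexity.Oracle.ofLanguage G)

/-! ### The stubs (the ONLY sorries of the file) -/

/-- STUB 1 (L, provable now): Cohen generics separate `PromiseBQP` from `PromiseBPP'` (the Forrelation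
promise problem of the prefixed Raz–Tal machine read off the generic; density of the error-forcing
conditions from the stage lemma `exists_defeating_window_bpp`; `IsGeneric.of_forces`). -/
theorem stub_genericPromiseSep : GenericPromiseSep := by
  sorry

/-- STUB 2 (open core, summit-hard, necessary for the summit): the promise lift at a Cohen generic. -/
theorem stub_genericPromiseLift : GenericPromiseLift := by
  sorry

/-! ### Name-keyed aliases of the stub statements (hypotheses of the composition, A12 audit) -/

namespace Registered

/-- Alias of stub 1's statement keyed by the registered stub name. -/
abbrev stub_genericPromiseSep : Prop := GenericPromiseSep

/-- Alias of stub 2's statement keyed by the registered stub name. -/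
abbrev stub_genericPromiseLift : Prop := GenericPromiseLift

end Registered

/-! ### Kernel-checked composition -/

/-- COMPOSITION (real proof, no sorry): the two stubs give the crux `GenSep` BY NAME. Given a
countable `𝒮`, a generic for the countable family `𝒮 ∪ 𝒮₀ ∪ 𝒮₁` exists (`exists_isGeneric`,
FFKL03 Lemma 3.12) and is generic for each part (`isGeneric_union`); at it the promise classes are
separated (stub 1), so the language classes cannot collapse (stub 2). -/
theorem GenSep_of (h₁ : Registered.stub_genericPromiseSep) (h₂ : Registered.stub_genericPromiseLift) :
    Summit.QuantumAdvantage.QuantumAdvantage.Theses.GenericInertness.GenSep := by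
  obtain ⟨𝒮₀, h₀c, h₀⟩ := id (α := GenericPromiseSep) h₁
  obtain ⟨𝒮₁, h₁c, h₁l⟩ := id (α := GenericPromiseLift) h₂
  intro 𝒮 h𝒮
  obtain ⟨G, hG⟩ :=
    Literature.Computability.Complexity.exists_isGeneric ((h𝒮.union h₀c).union h₁c)
  have hG' := Literature.Computability.Complexity.isGeneric_union.1 hG
  have hG'' := Literature.Computability.Complexity.isGeneric_union.1 hG'.1
  exact ⟨G, hG''.1, fun hsub => h₀ G hG''.2 (h₁l G hG'.2 hsub)⟩

/-- Consistency check only (an `example`, so nothing sorry-tainted concluding the crux enters the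
environment — a later `exact?` probe importing this file cannot pick up a fake proof of `GenSep`):
the composition typechecks against the stubs exactly as stated. -/
example : Summit.QuantumAdvantage.QuantumAdvantage.Theses.GenericInertness.GenSep :=
  GenSep_of stub_genericPromiseSep stub_genericPromiseLift

end Summit.QuantumAdvantage.QuantumAdvantage.Cruxes.GenSep.Birth
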